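import Literature.Probability.Percolation.ArmSeparationOutFrames
import Literature.Probability.Percolation.AltFourArm
import Literature.Probability.Percolation.AnnulusAlternationBlocks
import Literature.Probability.Percolation.ArmSeparationOutFramesAt
import HarnessLib

/-!
# The guarded outer separation step for four alternating arms — generic pieces

Topic: Probability / Percolation; family `crit-perc` / near-critical percolation on `𝕋`. Bricks of
the four-arm, alternating-colour case (`j = 4`, `σ = BWBW`) of Kesten's arm separation theorem
(Nolin 2008, Thm. 11 [arXiv 0711.4948: Thm. 10]) on top of the two-arm outer step of
`ArmSeparationOutFrames.lean` (`outBad`, `OutGoodFr`, `exists_trapFencedArm_mid`): the fencing of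
ONE arm given as an explicit path, keeping track of its start (the cluster-form non-connection
clauses of `altFourArm` are stated for the starts of the arms) — the two-arm statement
`exists_trapFencedArm_mid` hides the start behind `Nonempty`.

* `PathIn.exists_first_reach` — an annulus path from norm `≤ N` to norm `≥ N` passes through a
  site of norm exactly `N`, by a sub-path of the smaller annulus;
* `exists_frame_of_pathIn` — a colour-`b` path of `{n ≤ |v| ≤ 2M}` ending on `∂Λ_{2M}` is carried
  by some frame `(frameIso i)⁻¹` (`i < 6`) to one ending on `trapO M`;
* `exists_trapFencedArm_mid_start` — `exists_trapFencedArm_mid` with the start exposed: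
  `∃ F, GoodTip M R₀ F.z ∧ F.a = a`.

Everything here is proved; no named facts are introduced.

## References

* P. Nolin, *Near-critical percolation in two dimensions*, Electron. J. Probab. 13 (2008), §4.4,
  Lemma 15 and proof of Thm. 11 [arXiv 0711.4948: Lemma 14, Thm. 10]. [Nolin2008]
* H. Kesten, *Scaling relations for 2D-percolation*, Comm. Math. Phys. 109 (1987), Lemma 4. [Kesten1987]
-/

noncomputable section

open Set

namespace Literature.Probability.Percolation

open LatticeModels

/-- **First reach of a level.** A `𝕋`-path of `triAnn n R ∩ X` from a site of norm `≤ N` to a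
site of norm `≥ N` contains a site of norm exactly `N` reached by a sub-path of `triAnn n N ∩ X`
(norms change by at most one along an edge). [folklore] -/
theorem PathIn.exists_first_reach {n R N : ℕ} {X : Set (Site 2)} {a b : Site 2}
    (hp : PathIn triGraph (triAnn n R ∩ X) a b) (ha : triNorm a ≤ N) (hb : (N : ℤ) ≤ triNorm b) :
    ∃ t : Site 2, triNorm t = N ∧ PathIn triGraph (triAnn n N ∩ X) a t := by
  rcases ha.lt_or_eq with hlt | heq
  · obtain ⟨a', b', ha', hb', hb'X, hadj, hq⟩ :=
      hp.exit (R := {v : Site 2 | triNorm v < N}) hlt (by simp only [Set.mem_setOf_eq, not_lt]; exact hb)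
    simp only [Set.mem_setOf_eq, not_lt] at ha' hb'
    have h1 := triNorm_le_triNorm_add_one_of_adj hadj
    have hbN : triNorm b' = N := by omega
    refine ⟨b', hbN, (hq.mono ?_).tail hadj ⟨mem_triAnn.2 ⟨(mem_triAnn.1 hb'X.1).1, hbN.le⟩, hb'X.2⟩⟩
    rintro v ⟨hvR, hvA, hvX⟩
    exact ⟨mem_triAnn.2 ⟨(mem_triAnn.1 hvA).1, le_of_lt hvR⟩, hvX⟩
  · exact ⟨a, heq, PathIn.refl ⟨mem_triAnn.2 ⟨(mem_triAnn.1 hp.left_mem.1).1, heq.le⟩, hp.left_mem.2⟩⟩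

/-- **Framing an explicit arm.** A colour-`b` `𝕋`-path of the annulus `{n ≤ |v| ≤ 2M}` from `a`
to a site `t` of norm `2M` is carried by `(frameIso i)⁻¹`, for the `i < 6` turning the side of `t`
to side `0`, to a colour-`b` path of `frameConfig i ω` from `(frameIso i)⁻¹ a` to
`(frameIso i)⁻¹ t ∈ trapO M` (as in `exists_trapO_pathIn_frame`, which starts from the arm event
instead of a path). [cite: Nolin2008, §4.4 (arXiv 0711.4948: proof of Thm. 10)] -/
theorem exists_frame_of_pathIn {n M : ℕ} (hM : 1 ≤ M) {ω : SiteConfig (Site 2)} {b : Bool} {a t : Site 2}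
    (hp : PathIn triGraph (triAnn n (2 * M) ∩ {v | v ∈ ω ↔ b}) a t) (ht : triNorm t = 2 * M) :
    ∃ i < 6, (frameIso i).symm t ∈ trapO M ∧
      PathIn triGraph (triAnnSet n (2 * M) ∩ {v | v ∈ frameConfig i ω ↔ b}) ((frameIso i).symm a) ((frameIso i).symm t) := by
  obtain ⟨i, hi, hi0⟩ := exists_frame_symm_apply_zero_eq t
  have hp' : PathIn triGraph (triAnnSet n (2 * M) ∩ {v | v ∈ ω ↔ b}) a t :=
    hp.mono fun v hv => ⟨⟨(mem_triAnn.1 hv.1).1, by push_cast; exact (mem_triAnn.1 hv.1).2⟩, hv.2⟩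
  have hq := pathIn_frameConfig i hp'
  refine ⟨i, hi, ?_, hq.mono ?_⟩
  · refine mem_trapO_of_apply_zero_eq hM (by rw [triNorm_frameIso_symm i hi, ht]) ?_
    rw [hi0, ht]
  · rintro w ⟨⟨v, hv, rfl⟩, hw⟩
    refine ⟨?_, hw⟩
    rw [mem_triAnnSet] at hv ⊢
    rw [show ((frameIso i).symm : triGraph ≃g triGraph) v = (frameIso i).symm v from rfl, triNorm_frameIso_symm i hi]
    exact hv

/-- **Fenced arm with a middle tip, start exposed**: off the bad event (`χ ∉ outBad`), a
`χ`-open path of `{n ≤ |v| ≤ 2M}` from a site `a` of norm `n ≤ M` to `trapO M` yields a fenced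
arm `F` (`TrapFencedArm`) with `F.a = a` whose tip is a middle tip (`GoodTip`) — the proof of
`exists_trapFencedArm_mid`, through `trap_reroute`. [cite: Nolin2008, §4.4 Lemma 15 and Thm. 11 (proof) (arXiv 0711.4948: Lemma 14, Thm. 10)] -/
theorem exists_trapFencedArm_mid_start {M n T k₀ K R₀ Kg : ℕ} (hnM : n ≤ M) (hR₀ : 1 ≤ R₀)
    (hRg : ∀ i < Kg, 2 * trapScale R₀ i ≤ M) {χ : SiteConfig (Site 2)} (hχ : χ ∉ outBad M T k₀ K R₀ Kg)
    {a y : Site 2} (ha : triNorm a = n) (hy : y ∈ trapO M) (hp : PathIn triGraph (triAnnSet n (2 * M) ∩ χ) a y) :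
    ∃ F : TrapFencedArm M n k₀ K χ, GoodTip M R₀ F.z ∧ F.a = a := by
  simp only [outBad, Set.mem_setOf_eq, not_or, not_not] at hχ
  obtain ⟨hfail, ⟨i₀, hi₀, hG₀⟩, ⟨i₁, hi₁, hG₁⟩⟩ := hχ
  simp only [OutFail, not_or, not_exists, not_and, ne_eq, not_not] at hfail
  obtain ⟨hT, hOK⟩ := hfail
  have ha0 : a 0 ≤ M := by
    have h1 : a 0 ≤ triNorm a := by rw [triNorm_eq_max]; simp only [le_max_iff]; exact Or.inl (Or.inl le_rfl)
    have : (n : ℤ) ≤ M := by exact_mod_cast hnM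
    omega
  obtain ⟨z, hz, j, hj, m, hOKm, hpath, htip⟩ := trap_reroute hnM hT hOK ha0 hy hp
  set F : TrapFencedArm M n k₀ K χ := ⟨z, j, m, a, hz, hj, ha, hOKm, hpath, htip⟩ with hF
  have hk₀ : 1 ≤ trapScale R₀ i₀ := one_le_trapScale hR₀ _
  have hk₁ : 1 ≤ trapScale R₀ i₁ := one_le_trapScale hR₀ _
  have hmid := ext_tip_bounds_of_guards hk₀ (hRg i₀ hi₀) hk₁ (hRg i₁ hi₁) hG₀.1 hG₁.1
    (by rw [F.norm_a]; exact_mod_cast hnM) F.z_mem F.path_tip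
  have hR₀k₀ : (R₀ : ℤ) ≤ trapScale R₀ i₀ := by exact_mod_cast le_trapScale R₀ i₀
  have hR₀k₁ : (R₀ : ℤ) ≤ trapScale R₀ i₁ := by exact_mod_cast le_trapScale R₀ i₁
  exact ⟨F, ⟨by omega, by omega⟩, rfl⟩

/-! ### The output event of the four-arm outer step, and the assembly -/

/-- **The output of the outer separation step for four alternating arms** (Nolin's
`Ã_{4,BWBW}(n, 2M)` after the first step of the proof of Thm. 11, in cluster form made planar):
frames `i j < 6` and four fenced arms with middle tips — open ones `F₀`, `F₂` of
`frameConfig (i 0) ω`, `frameConfig (i 2) ω`, closed ones `F₁`, `F₃` (open arms of the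
complements) — whose ACTUAL tips `ζ_j = frameIso (i j) (F_j.z) ∈ ∂Λ_{2M}` are in the anticlockwise
cyclic order `ζ₁ < ζ₂ < ζ₃ < ζ₀` from some origin `r ∈ ∂Λ_{2M}` (`hexShift`), i.e. the colours
alternate `W B W B` around `∂Λ_{2M}`. [cite: Nolin2008, §4.1 and §4.4 (arXiv 0711.4948: proof of Thm. 10, first step, j = 4, σ = BWBW)] -/
def OutMidTiny4 (M n k₀ K R₀ : ℕ) : Set (SiteConfig (Site 2)) :=
  {ω | ∃ i : Fin 4 → ℕ, (∀ j, i j < 6) ∧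
    ∃ F₀ : TrapFencedArm M n k₀ K (frameConfig (i 0) ω), ∃ F₁ : TrapFencedArm M n k₀ K (frameConfig (i 1) ω)ᶜ,
    ∃ F₂ : TrapFencedArm M n k₀ K (frameConfig (i 2) ω), ∃ F₃ : TrapFencedArm M n k₀ K (frameConfig (i 3) ω)ᶜ,
      GoodTip M R₀ F₀.z ∧ GoodTip M R₀ F₁.z ∧ GoodTip M R₀ F₂.z ∧ GoodTip M R₀ F₃.z ∧
      ∃ r : Site 2, triNorm r = 2 * M ∧
        hexShift (2 * M) r (frameIso (i 1) F₁.z) < hexShift (2 * M) r (frameIso (i 2) F₂.z) ∧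
        hexShift (2 * M) r (frameIso (i 2) F₂.z) < hexShift (2 * M) r (frameIso (i 3) F₃.z) ∧
        hexShift (2 * M) r (frameIso (i 3) F₃.z) < hexShift (2 * M) r (frameIso (i 0) F₀.z)}

/-- The tip of a fenced arm of a framed configuration, back in the original frame, is joined to
the (un-framed) start by a colour-`b` path of the annulus `{n ≤ |v| ≤ 2M}`, and has norm `2M`. [folklore] -/
theorem TrapFencedArm.pathIn_frameIso_tip {M n k₀ K i : ℕ} (hi : i < 6) {ω : SiteConfig (Site 2)} {b : Bool}
    (F : TrapFencedArm M n k₀ K {v | v ∈ frameConfig i ω ↔ b}) :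
    PathIn triGraph (triAnn n (2 * M) ∩ {v | v ∈ ω ↔ b}) (frameIso i F.a) (frameIso i F.z) ∧
      triNorm (frameIso i F.z) = 2 * M := by
  refine ⟨(pathIn_of_frameConfig i F.path_tip).mono ?_, ?_⟩
  · rintro w ⟨⟨v, hv, rfl⟩, hw⟩
    refine ⟨mem_triAnn.2 ?_, hw⟩
    rw [show ((frameIso i : triGraph ≃g triGraph) v) = frameIso i v from rfl, triNorm_frameIso i hi]
    rw [mem_triAnnSet] at hv
    exact ⟨hv.1, by exact_mod_cast hv.2⟩
  · rw [triNorm_frameIso i hi]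
    have := mem_trapD.1 (mem_trapO.1 F.z_mem).1
    have h2 := (mem_trapO.1 F.z_mem).2
    rw [triNorm_eq_max]
    have h0 := trapO_coord F.z_mem
    omega

/-- **Assembly: on the alternating four-arm event, if nothing fails around `∂Λ_{2M}` and the
corners are guarded, the four arms are fenced with middle tips in the alternating cyclic order**:
`altFourArm n (2M) ∩ {OutGoodFr M T k₀ K R₀ K_g} ⊆ OutMidTiny4 M n k₀ K R₀` (`2 ≤ M`, `1 ≤ n ≤ M`,
`1 ≤ R₀`, `2 R₀ 32^i ≤ M` for `i < K_g`). The two OPEN arms of the witness family, which lie in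
distinct open clusters of the annulus, are kept; the closed arms are REPLACED by the two frontier
chains of `exists_frontierChains_alternating` (closed crossings hugging the cluster of the first
open arm on the side of the second, not joined by a closed path); each of the four is fenced in
its frame (`exists_trapFencedArm_mid_start`); the fenced tips stay in the clusters of their arms
inside the annulus (`TrapFencedArm.path_tip`), whose footprints on `∂Λ_{2M}` are in the block
order `K₁ < C₂ < K₂ < Cl` anticlockwise from `τ₁` (`annFrontier_order`, `annFrontier_block_one/two`). [cite: Nolin2008, §4.1, §4.4 (arXiv 0711.4948: proof of Thm. 10, first step)] -/
theorem altFourArm_inter_outGoodFr_subset {M n T k₀ K R₀ Kg : ℕ} (hM : 2 ≤ M) (hn : 1 ≤ n) (hnM : n ≤ M)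
    (hR₀ : 1 ≤ R₀) (hRg : ∀ i < Kg, 2 * trapScale R₀ i ≤ M) :
    altFourArm n (2 * M) ∩ {ω | OutGoodFr M T k₀ K R₀ Kg ω} ⊆ OutMidTiny4 M n k₀ K R₀ := by
  classical
  rintro ω ⟨⟨x, y, w, hw, -, hopen, -⟩, hgood⟩
  have hM1 : 1 ≤ M := by omega
  have hN : n + 2 ≤ 2 * M := by omega
  have hn2M : n ≤ 2 * M := by omega
  have hxn : ∀ j, triNorm (x j) = n := fun j => mem_triSphere_iff.1 (hw j).1
  have hyn : ∀ j, triNorm (y j) = 2 * M := fun j => by have := mem_triSphere_iff.1 (hw j).2.1; push_cast at this; exact this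
  have hsuppAnn : ∀ j, ∀ v ∈ (w j).support, v ∈ triAnn n (2 * M) :=
    fun j v hv => mem_triAnn_of_support hn2M ((hw j).2.2.2.1 v hv)
  have hcol0 : ∀ v ∈ (w 0).support, v ∈ ω := fun v hv => by simpa using (hw 0).2.2.2.2 v hv
  have hcol2 : ∀ v ∈ (w 2).support, v ∈ ω := fun v hv => by simpa using (hw 2).2.2.2.2 v hv
  -- the two open arms as paths of the annulus
  have hB₁ : PathIn triGraph (triAnn n (2 * M) ∩ ω) (x 0) (y 0) :=
    PathIn.of_walk (w 0) fun v hv => ⟨hsuppAnn 0 v hv, hcol0 v hv⟩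
  have hB₂ : PathIn triGraph (triAnn n (2 * M) ∩ ω) (x 2) (y 2) :=
    PathIn.of_walk (w 2) fun v hv => ⟨hsuppAnn 2 v hv, hcol2 v hv⟩
  have hsep : ¬ PathIn triGraph (triAnn n (2 * M) ∩ ω) (x 0) (x 2) :=
    hopen _ (SimpleGraph.Walk.start_mem_support _) _ (SimpleGraph.Walk.start_mem_support _)
  -- the frontier chains and the certified order
  obtain ⟨Fr, hnot, h0t, ht2, hτ2⟩ := exists_frontierChains_alternating hn hN hB₁ (hxn 0) (hyn 0) hB₂ (hxn 2) (hyn 2) hsep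
  obtain ⟨hI, hII, hIII, hIV⟩ := annFrontier_order hn hN Fr
  -- the four arms as colour paths ending on `∂Λ_{2M}`
  have hA0 : PathIn triGraph (triAnn n (2 * M) ∩ {v | v ∈ ω ↔ true}) (x 0) (y 0) :=
    hB₁.mono fun v hv => ⟨hv.1, by simpa using hv.2⟩
  have hA2 : PathIn triGraph (triAnn n (2 * M) ∩ {v | v ∈ ω ↔ true}) (x 2) (y 2) :=
    hB₂.mono fun v hv => ⟨hv.1, by simpa using hv.2⟩
  have hA1 : PathIn triGraph (triAnn n (2 * M) ∩ {v | v ∈ ω ↔ false}) Fr.σ₁ Fr.τ₁ :=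
    Fr.chain₁.mono fun v hv => ⟨(annFrontier_subset hv).1, by simpa using (annFrontier_subset hv).2⟩
  have hA3 : PathIn triGraph (triAnn n (2 * M) ∩ {v | v ∈ ω ↔ false}) Fr.σ₂ Fr.τ₂ :=
    Fr.chain₂.symm.mono fun v hv => ⟨(annFrontier_subset hv).1, by simpa using (annFrontier_subset hv).2⟩
  -- frame and fence each arm
  obtain ⟨i0, hi0, hy0, hP0⟩ := exists_frame_of_pathIn hM1 hA0 (hyn 0)
  obtain ⟨i1, hi1, hy1, hP1⟩ := exists_frame_of_pathIn hM1 hA1 Fr.norm_τ₁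
  obtain ⟨i2, hi2, hy2, hP2⟩ := exists_frame_of_pathIn hM1 hA2 (hyn 2)
  obtain ⟨i3, hi3, hy3, hP3⟩ := exists_frame_of_pathIn hM1 hA3 Fr.norm_τ₂
  rw [setOf_mem_iff_true] at hP0 hP2
  rw [setOf_mem_iff_false] at hP1 hP3
  have hs0 : triNorm ((frameIso i0).symm (x 0)) = n := by rw [triNorm_frameIso_symm i0 hi0, hxn 0]
  have hs2 : triNorm ((frameIso i2).symm (x 2)) = n := by rw [triNorm_frameIso_symm i2 hi2, hxn 2]
  have hs1 : triNorm ((frameIso i1).symm Fr.σ₁) = n := by rw [triNorm_frameIso_symm i1 hi1, Fr.norm_σ₁]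
  have hs3 : triNorm ((frameIso i3).symm Fr.σ₂) = n := by rw [triNorm_frameIso_symm i3 hi3, Fr.norm_σ₂]
  obtain ⟨F₀, hG₀, ha₀⟩ := exists_trapFencedArm_mid_start hnM hR₀ hRg (hgood i0 hi0).1 hs0 hy0 hP0
  obtain ⟨F₁, hG₁, ha₁⟩ := exists_trapFencedArm_mid_start hnM hR₀ hRg (hgood i1 hi1).2 hs1 hy1 hP1
  obtain ⟨F₂, hG₂, ha₂⟩ := exists_trapFencedArm_mid_start hnM hR₀ hRg (hgood i2 hi2).1 hs2 hy2 hP2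
  obtain ⟨F₃, hG₃, ha₃⟩ := exists_trapFencedArm_mid_start hnM hR₀ hRg (hgood i3 hi3).2 hs3 hy3 hP3
  -- the actual tips, back in the original frame, are in the clusters of their arms
  have back : ∀ {i : ℕ} (hi : i < 6) {χ : SiteConfig (Site 2)} (F : TrapFencedArm M n k₀ K χ) {b : Bool}
      (hχ : (χ : Set (Site 2)) = {v | v ∈ frameConfig i ω ↔ b}),
      PathIn triGraph (triAnn n (2 * M) ∩ {v | v ∈ ω ↔ b}) (frameIso i F.a) (frameIso i F.z) ∧
        triNorm (frameIso i F.z) = 2 * M := by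
    intro i hi χ F b hχ
    have hp : PathIn triGraph (triAnnSet n (2 * M) ∩ {v | v ∈ frameConfig i ω ↔ b}) F.a F.z := by
      rw [← hχ]; exact F.path_tip
    refine ⟨(pathIn_of_frameConfig i hp).mono ?_, ?_⟩
    · rintro v' ⟨⟨v, hv, rfl⟩, hw⟩
      refine ⟨mem_triAnn.2 ?_, hw⟩
      rw [show ((frameIso i : triGraph ≃g triGraph) v) = frameIso i v from rfl, triNorm_frameIso i hi]
      rw [mem_triAnnSet] at hv
      exact ⟨hv.1, by exact_mod_cast hv.2⟩
    · rw [triNorm_frameIso i hi]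
      have h0 := trapO_coord F.z_mem
      rw [triNorm_eq_max]
      omega
  obtain ⟨hq0, hz0⟩ := back hi0 F₀ (b := true) (by rw [setOf_mem_iff_true])
  obtain ⟨hq1, hz1⟩ := back hi1 F₁ (b := false) (by rw [setOf_mem_iff_false])
  obtain ⟨hq2, hz2⟩ := back hi2 F₂ (b := true) (by rw [setOf_mem_iff_true])
  obtain ⟨hq3, hz3⟩ := back hi3 F₃ (b := false) (by rw [setOf_mem_iff_false])
  rw [ha₀, RelIso.apply_symm_apply] at hq0
  rw [ha₁, RelIso.apply_symm_apply] at hq1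
  rw [ha₂, RelIso.apply_symm_apply] at hq2
  rw [ha₃, RelIso.apply_symm_apply] at hq3
  set ζ₀ := frameIso i0 F₀.z with hζ₀
  set ζ₁ := frameIso i1 F₁.z with hζ₁
  set ζ₂ := frameIso i2 F₂.z with hζ₂
  set ζ₃ := frameIso i3 F₃.z with hζ₃
  -- colour paths as set paths
  have hc0 : PathIn triGraph (triAnn n (2 * M) ∩ ω) (x 0) ζ₀ := hq0.mono fun v hv => ⟨hv.1, by simpa using hv.2⟩
  have hc2 : PathIn triGraph (triAnn n (2 * M) ∩ ω) (x 2) ζ₂ := hq2.mono fun v hv => ⟨hv.1, by simpa using hv.2⟩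
  have hk1 : PathIn triGraph (triAnn n (2 * M) \ ω) Fr.τ₁ ζ₁ :=
    (Fr.chain₁.symm.mono fun v hv => annFrontier_subset hv).trans (hq1.mono fun v hv => ⟨hv.1, by simpa using hv.2⟩)
  have hk3 : PathIn triGraph (triAnn n (2 * M) \ ω) Fr.τ₂ ζ₃ :=
    (Fr.chain₂.mono fun v hv => annFrontier_subset hv).trans (hq3.mono fun v hv => ⟨hv.1, by simpa using hv.2⟩)
  -- the order
  have o12 : hexShift (2 * M) Fr.τ₁ ζ₁ < hexShift (2 * M) Fr.τ₁ ζ₂ :=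
    annFrontier_block_one hn hN hB₁ (hxn 0) (hyn 0) (hxn 2) hsep Fr hk1 hz1 hc2 hz2
  have o23 : hexShift (2 * M) Fr.τ₁ ζ₂ < hexShift (2 * M) Fr.τ₁ ζ₃ :=
    annFrontier_block_two hn hN hB₁ (hxn 0) (hyn 0) (hxn 2) hsep Fr hk3 hz3 hc2 hz2
  have hζ₃U : ζ₃ ∈ annComp n (2 * M) ω (x 0) (x 2) := by
    have hτ₂U : Fr.τ₂ ∈ annComp n (2 * M) ω (x 0) (x 2) := annFrontier_subset_annComp Fr.chain₂.left_mem
    exact hτ₂U.trans (hk3.mono fun z hz => ⟨hz.1, fun hzCl => hz.2 (annCluster_subset hzCl).2⟩)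
  have o30 : hexShift (2 * M) Fr.τ₁ ζ₃ < hexShift (2 * M) Fr.τ₁ ζ₀ :=
    lt_of_le_of_lt (hII ζ₃ hζ₃U hz3) (hIII ζ₀ hc0 hz0)
  refine ⟨![i0, i1, i2, i3], fun j => by fin_cases j <;> assumption, F₀, F₁, F₂, F₃, hG₀, hG₁, hG₂, hG₃,
    Fr.τ₁, Fr.norm_τ₁, o12, o23, o30⟩

/-- **The outer separation step for four alternating arms, at a general density `p`** (Nolin
2008, §4.4, first step of the proof of Thm. 11, `j = 4`, `σ = BWBW`, "uniformly in `p`"):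
`P_p(altFourArm n (2M)) ≤ P_p(OutMidTiny4 M n k₀ K R₀) + P_p(¬ OutGoodFr M T k₀ K R₀ K_g) · P_p(altFourArm n M)`
(`2 ≤ M`, `1 ≤ n ≤ M`, `1 ≤ R₀`, `2 k_j + 1 ≤ R < M`, `16 R₀ 32^i ≤ R_g < M`): off `OutGoodFr` the
four arms still cross `{n ≤ |v| ≤ M}` (`altFourArm_anti`), an event determined by `Λ_M`,
independent of `OutGoodFr` (`real_le_outStepFr_at`). [cite: Nolin2008, §4.4 (arXiv 0711.4948: proof of Thm. 10, p. 12), with Thm. 11 "uniformly in p"] -/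
theorem real_altFourArm_le_outStepFr_at (p : unitInterval) {M n T k₀ K R₀ Kg R Rg : ℕ} (hM : 2 ≤ M)
    (hn : 1 ≤ n) (hnM : n ≤ M) (hR₀ : 1 ≤ R₀)
    (hR : ∀ j < K, 2 * trapScale k₀ j + 1 ≤ R) (hRM : R < M) (hRg : ∀ i < Kg, 16 * trapScale R₀ i ≤ Rg) (hRgM : Rg < M) :
    (triSitePercolation p).real (altFourArm n (2 * M)) ≤
      (triSitePercolation p).real (OutMidTiny4 M n k₀ K R₀) +
        (triSitePercolation p).real {ω | ¬ OutGoodFr M T k₀ K R₀ Kg ω} *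
          (triSitePercolation p).real (altFourArm n M) := by
  have hM1 : 1 ≤ M := by omega
  have hRg' : ∀ i < Kg, 2 * trapScale R₀ i ≤ M := fun i hi => by have := hRg i hi; omega
  refine real_le_outStepFr_at p hM1 hR hRM hRg hRgM ?_ ?_
  · refine (determinedBy_altFourArm hnM).mono ?_
    intro v hv
    rw [Finset.mem_coe, mem_triAnnulus] at hv
    rw [Finset.mem_coe, mem_triBall_iff]
    exact hv.2
  · intro ω hω
    by_cases hg : OutGoodFr M T k₀ K R₀ Kg ω
    · exact Or.inl (altFourArm_inter_outGoodFr_subset hM hn hnM hR₀ hRg' ⟨hω, hg⟩)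
    · exact Or.inr ⟨hg, altFourArm_anti n hnM (by omega) hω⟩

end Literature.Probability.Percolation
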